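import Literature.NumberTheory.EllipticCurves.Zywina2025RankTwo
import Literature.NumberTheory.EllipticCurves.LocalTorsionMultiplicativeProofs
import Literature.NumberTheory.EllipticCurves.CanonicalPAdicHeightAdmissibilityCriteria
import Literature.NumberTheory.EllipticCurves.Rank1Residual.X11RankOneCertificates.Minimality
import Literature.NumberTheory.EllipticCurves.RationalIsogenyFrobeniusCriterion
import HarnessLib

/-!
# Zywina 2025, Lemma 3.4: `E_{m,n}(ℚ)_tors = ℤ/2`, hence Theorem 1.2 verbatim
# (`E_{m,n}(ℚ) ≅ ℤ/2ℤ × ℤ²`)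

D. Zywina, *There are infinitely many elliptic curves over the rationals of rank 2*,
arXiv:2502.01957 (2025) [Zywina2025], Lemma 3.4 (p. 7): "The torsion subgroup of `E(ℚ)` is the
cyclic group of order `2` generated by `P₀`", for `E = E_{m,n} : y² = x³ - 5(m+16n²)x² +
4(m+16n²)(m+25n²)x`, `(m, n)` admissible (`m`, `m+16n²`, `m+25n²` primes `≡ 11 (mod 24)`); with
Lemma 3.5 / the tree's `mordellWeilRank_zywinaCurve` (`rank E(ℚ) = 2`) this is Theorem 1.2 as
printed: "`E(ℚ) ≅ ℤ/2ℤ × ℤ²`".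

PROOF FORMALISED HERE. Zywina's own argument is `2`-adic (the equation is minimal at `2`,
`Ẽ_ns(𝔽₂)` is trivial so `E₁(ℚ₂) = E₀(ℚ₂)`, Kodaira type `I_r^*` at `2` so `[E(ℚ₂) : E₀(ℚ₂)] ∈ {2, 4}`,
and `E₁(ℚ₂)_tors` is a `2`-group). We run THE SAME LOCAL ARGUMENT AT THE PRIME `3` instead, where
every input is already a theorem of the tree: the integral equation is a global minimal model
(`Δ = 2⁸·3²·m·q³·r²`, all exponents `< 12`); `3 ∣ Δ`, `3 ∤ c₄ = 16q(13m+100n²)` (since `12 ∣ n`), so the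
reduction at `3` is MULTIPLICATIVE of type `I₂`; hence (Silverman *AEC* VII.2.1, VII.6.1, Ex. 3.5,
tree: `index_formalFiltration`, `reductionPointCount_of_mult`,
`localTamagawaNumber_eq_ordMinimalDiscriminant_of_hasSplitMultiplicativeReductionAt`,
`localTamagawaNumber_of_hasNonsplitMultiplicativeReductionAt_holds`)
`[E(ℚ₃) : E₁(ℚ₃)] = c₃ · #Ẽ_ns(𝔽₃) ∈ {2·2, 1·4, 2·4}` divides `8`, while a rational point of `E₁(ℚ₃)`
is never torsion (AEC VII.3.1/IV.6.1, tree: `not_isOfFinAddOrder_of_one_lt_norm`). So every torsion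
point of `E(ℚ)` is killed by `8` (`eight_nsmul_eq_zero_of_isOfFinAddOrder`): `E(ℚ)_tors` is a
`2`-group. The `2`-part is Zywina's: `E(ℚ)[2] = {O, P₀}` (tree: `natCard_torsionBy_two_zywinaCurve`)
and `P₀ ∉ 2E(ℚ)` because the descent map `α : E(ℚ) → ℚ^×/ℚ^×²` (tree: `xSqClass`, a homomorphism)
kills `2E(ℚ)` but `α(P₀) = [4qr] ≠ 1` (`q ≠ r` primes) — Zywina: "`P₀ = 2P = φ̂(φ(P)) ∈ φ̂(E′(ℚ))`
contradicts Lemma 3.3(ii)". Hence `E(ℚ)_tors = {O, P₀}`.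

Contents (all PROVED, no named fact; `(m, n)` admissible throughout):
* `zywinaCurveInt m n` — the equation as a Weierstrass curve over `ℤ`, `zywinaCurveInt_baseChange`;
  `zywinaCurveInt_Δ` (`= 2⁸3²mq³r²`), `zywinaCurveInt_c₄` (`= 16q(13m+100n²)`);
* `isGloballyMinimal_zywinaCurve`; `three_dvd_Δ`, `not_three_dvd_c₄`, `padicValInt_three_Δ`;
* `hasMultiplicativeReductionAtPrime_three_zywinaCurve`,
  `localTamagawaNumber_three_dvd_two`, `reductionPointCount_three_dvd_four`,
  `index_formalFiltration_three_dvd_eight`;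
* **`eight_nsmul_eq_zero_of_isOfFinAddOrder`** — every torsion point of `E_{m,n}(ℚ)` is killed by `8`;
* `eq_zero_or_eq_twoTorsionPoint_of_two_nsmul_eq_zero` (`E(ℚ)[2] = {O, P₀}`),
  `twoTorsionPoint_ne_two_nsmul` (`P₀ ∉ 2E(ℚ)`);
* **`eq_zero_or_eq_twoTorsionPoint_of_isOfFinAddOrder`** (Lemma 3.4: `E(ℚ)_tors = {O, P₀}`),
  `natCard_torsion_zywinaCurve` / `torsionOrder_zywinaCurve` (`#E(ℚ)_tors = 2`), the packaging
  `mordellWeilRank_eq_two_and_torsionOrder_eq_two` (Theorem 1.2 as printed, read as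
  `rank = 2 ∧ #tors = 2`), and `infinite_setOf_j_mordellWeilRank_eq_two_and_torsionOrder_eq_two`
  (Theorems 1.1 + 1.2: infinitely many `j` with `E(ℚ) ≅ ℤ/2ℤ × ℤ²`, modulo the tree's named fact
  `zywinaSet_infinite`, itself derived from Tao–Ziegler in `Zywina2025AdmissibleClasses`).

## References
* [Zywina2025] D. Zywina, arXiv:2502.01957, Thm. 1.2, Lemma 3.4 (p. 7), Lemma 3.3(ii).
* [SilvermanAEC2009] J. H. Silverman, *The Arithmetic of Elliptic Curves*, 2nd ed., VII.1.1,
  VII.2.1, VII.3.1/VII.3.4, VII.5.1(b), VII.6.1, Ex. 3.5.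
-/

noncomputable section

open IsDedekindDomain NumberField Rat.HeightOneSpectrum WeierstrassCurve
  Literature.NumberTheory.EllipticCurves.Rank1Residual.X11RankOneCertificates

namespace Literature.NumberTheory.EllipticCurves.Zywina2025

/-! ### §1 The integer model and its invariants -/

/-- Zywina's equation `E_{m,n}` as a Weierstrass curve over `ℤ`:
`[0, -5(m+16n²), 0, 4(m+16n²)(m+25n²), 0]`. [cite: Zywina2025, Thm 1.2] -/
def zywinaCurveInt (m n : ℕ) : WeierstrassCurve ℤ where
  a₁ := 0
  a₂ := -5 * ((m + 16 * n ^ 2 : ℕ) : ℤ)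
  a₃ := 0
  a₄ := 4 * ((m + 16 * n ^ 2 : ℕ) : ℤ) * ((m + 25 * n ^ 2 : ℕ) : ℤ)
  a₆ := 0

/-- `zywinaCurveInt m n ⊗ ℚ = zywinaCurve m n`. [cite: Zywina2025, Thm 1.2] -/
theorem zywinaCurveInt_baseChange (m n : ℕ) :
    (zywinaCurveInt m n).baseChange ℚ = zywinaCurve m n := by
  rw [zywinaCurve_eq]
  ext <;> simp [zywinaCurveInt, baseChange, WeierstrassCurve.map]

/-- The same equality with the literal integer-cast model of `zywinaCurve_eq`. [cite: Zywina2025, Thm 1.2] -/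
theorem zywinaCurve_eq_intCast (m n : ℕ) :
    zywinaCurve m n = ⟨((0 : ℤ) : ℚ), ((-5 * ((m + 16 * n ^ 2 : ℕ) : ℤ) : ℤ) : ℚ), ((0 : ℤ) : ℚ),
      ((4 * ((m + 16 * n ^ 2 : ℕ) : ℤ) * ((m + 25 * n ^ 2 : ℕ) : ℤ) : ℤ) : ℚ), ((0 : ℤ) : ℚ)⟩ := by
  rw [zywinaCurve_eq]
  ext <;> simp

/-- **`Δ(E_{m,n}) = 2⁸ · 3² · m · q³ · r²`** (`q = m+16n²`, `r = m+25n²`; Zywina §3: `Δ = 2⁸3²mq³r²`,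
from `16b²(a² - 4b)` with `a² - 4b = 9mq`). [cite: Zywina2025, §3 (discriminant of E_{m,n})] -/
theorem zywinaCurveInt_Δ (m n : ℕ) :
    (zywinaCurveInt m n).Δ =
      2 ^ 8 * 3 ^ 2 * (m : ℤ) * ((m + 16 * n ^ 2 : ℕ) : ℤ) ^ 3 * ((m + 25 * n ^ 2 : ℕ) : ℤ) ^ 2 := by
  simp only [zywinaCurveInt, WeierstrassCurve.Δ, WeierstrassCurve.b₂, WeierstrassCurve.b₄,
    WeierstrassCurve.b₆, WeierstrassCurve.b₈]
  push_cast
  ring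

/-- **`c₄(E_{m,n}) = 16 · q · (13m + 100n²)`** (`16(a² - 3b) = 16q(25q - 12r)`).
[cite: Zywina2025, §3 (the model E_{m,n})] -/
theorem zywinaCurveInt_c₄ (m n : ℕ) :
    (zywinaCurveInt m n).c₄ = 16 * ((m + 16 * n ^ 2 : ℕ) : ℤ) * (13 * (m : ℤ) + 100 * (n : ℤ) ^ 2) := by
  simp only [zywinaCurveInt, WeierstrassCurve.c₄, WeierstrassCurve.b₂, WeierstrassCurve.b₄]
  push_cast
  ring

/-- The `discOf` of the certificate schema agrees with `Δ(E_{m,n})`. [folklore] -/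
private theorem discOf_zywina (m n : ℕ) :
    discOf [0, -5 * ((m + 16 * n ^ 2 : ℕ) : ℤ), 0,
      4 * ((m + 16 * n ^ 2 : ℕ) : ℤ) * ((m + 25 * n ^ 2 : ℕ) : ℤ), 0] =
      2 ^ 8 * 3 ^ 2 * (m : ℤ) * ((m + 16 * n ^ 2 : ℕ) : ℤ) ^ 3 * ((m + 25 * n ^ 2 : ℕ) : ℤ) ^ 2 := by
  simp only [discOf, invariants]
  push_cast
  ring

section Admissible

variable {m n : ℕ} (h : ZywinaAdmissible m n)
include h

/-- `12 ∣ n`-fragment used here: `3 ∣ n` (from `m ≡ m + 16n² ≡ 11 (mod 24)`). [cite: Zywina2025, Thm 1.2 (the congruences mod 24)] -/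
theorem three_dvd_n : 3 ∣ n := by
  obtain ⟨-, -, -, -, hm, hq, -⟩ := h
  have h3 : 3 ∣ 16 * n ^ 2 := by omega
  have h3' : 3 ∣ n ^ 2 := (Nat.Coprime.dvd_of_dvd_mul_left (by norm_num) h3)
  exact Nat.prime_three.dvd_of_dvd_pow h3'

/-- For every prime `ℓ`, `ℓ¹² ∤ Δ(E_{m,n}) = 2⁸3²mq³r²` (the five primes `2, 3, m, q, r` are distinct
and occur with exponents `8, 2, 1, 3, 2`). [cite: Zywina2025, §3 (discriminant of E_{m,n})] -/
theorem not_pow_twelve_dvd_Δ (ℓ : ℕ) (hℓ : ℓ.Prime) :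
    ¬ (ℓ : ℤ) ^ 12 ∣ (zywinaCurveInt m n).Δ := by
  have P := h.params
  set q : ℕ := m + 16 * n ^ 2 with hq
  set r : ℕ := m + 25 * n ^ 2 with hr
  have hm11 : 11 ≤ m := by have := P.m_mod; have := P.m_prime.two_le; omega
  have hmq : m < q := by have := P.n_pos; rw [hq]; nlinarith
  have hqr : q < r := by have := P.n_pos; rw [hq, hr]; nlinarith
  -- pass to `ℕ`
  rw [zywinaCurveInt_Δ]
  intro hdvd
  set N : ℕ := 2 ^ 8 * 3 ^ 2 * m * q ^ 3 * r ^ 2 with hN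
  have hcast : (2 ^ 8 * 3 ^ 2 * (m : ℤ) * (q : ℤ) ^ 3 * (r : ℤ) ^ 2) = (N : ℤ) := by
    rw [hN]; push_cast; ring
  rw [hcast, ← Int.natCast_pow, Int.natCast_dvd_natCast] at hdvd
  haveI : Fact ℓ.Prime := ⟨hℓ⟩
  haveI : Fact m.Prime := ⟨P.m_prime⟩
  haveI : Fact q.Prime := ⟨P.q_prime⟩
  haveI : Fact r.Prime := ⟨P.r_prime⟩
  have hN0 : N ≠ 0 := by
    rw [hN]; have := P.m_prime.pos; have := P.q_prime.pos; have := P.r_prime.pos; positivity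
  have hv : 12 ≤ padicValNat ℓ N := (padicValNat_dvd_iff_le hN0).mp hdvd
  -- `v_ℓ(N) = 8 v_ℓ(2) + 2 v_ℓ(3) + v_ℓ(m) + 3 v_ℓ(q) + 2 v_ℓ(r) ≤ 8`
  have hm0 : m ≠ 0 := P.m_prime.ne_zero
  have hq0 : q ≠ 0 := P.q_prime.ne_zero
  have hr0 : r ≠ 0 := P.r_prime.ne_zero
  have hvN : padicValNat ℓ N = 8 * padicValNat ℓ 2 + 2 * padicValNat ℓ 3 + padicValNat ℓ m +
      3 * padicValNat ℓ q + 2 * padicValNat ℓ r := by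
    rw [hN, padicValNat.mul (by positivity) (by positivity),
      padicValNat.mul (by positivity) (by positivity), padicValNat.mul (by positivity) (by positivity),
      padicValNat.mul (by positivity) (by positivity), padicValNat.pow, padicValNat.pow,
      padicValNat.pow, padicValNat.pow]
  -- `v_ℓ(s) = [ℓ = s]` for a prime `s`
  have hval : ∀ {s : ℕ}, s.Prime → ℓ ≠ s → padicValNat ℓ s = 0 := by
    intro s hs hls
    haveI : Fact s.Prime := ⟨hs⟩
    exact padicValNat_primes hls
  have hself : padicValNat ℓ ℓ = 1 := padicValNat_self
  have h23 : (2:ℕ) ≠ 3 := by norm_num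
  by_cases l2 : ℓ = 2
  · subst l2
    rw [hself, hval Nat.prime_three h23, hval P.m_prime (by omega), hval P.q_prime (by omega),
      hval P.r_prime (by omega)] at hvN
    omega
  by_cases l3 : ℓ = 3
  · subst l3
    rw [hself, hval Nat.prime_two (by omega), hval P.m_prime (by omega), hval P.q_prime (by omega),
      hval P.r_prime (by omega)] at hvN
    omega
  by_cases lm : ℓ = m
  · rw [hval Nat.prime_two l2, hval Nat.prime_three l3, hval P.q_prime (by omega),
      hval P.r_prime (by omega), lm, padicValNat_self] at hvN
    rw [lm] at hv
    omega
  by_cases lq : ℓ = q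
  · rw [hval Nat.prime_two l2, hval Nat.prime_three l3, hval P.m_prime lm, hval P.r_prime (by omega),
      lq, padicValNat_self] at hvN
    rw [lq] at hv
    omega
  by_cases lr : ℓ = r
  · rw [hval Nat.prime_two l2, hval Nat.prime_three l3, hval P.m_prime lm, hval P.q_prime lq, lr,
      padicValNat_self] at hvN
    rw [lr] at hv
    omega
  rw [hval Nat.prime_two l2, hval Nat.prime_three l3, hval P.m_prime lm, hval P.q_prime lq,
    hval P.r_prime lr] at hvN
  omega

/-- **`E_{m,n} : y² = x³ - 5qx² + 4qrx` is a global minimal model** (integral, and `ord_ℓ Δ < 12` at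
every prime `ℓ`; Silverman *AEC* VII.1.1, VIII.8 — Zywina uses minimality at `2`: "`ord₂(Δ) = 8 < 12`").
[cite: Zywina2025, Lemma 3.4 (proof: "minimal at 2 since … ord₂(Δ) = 8 < 12")] -/
theorem isGloballyMinimal_zywinaCurve : (zywinaCurve m n).IsGloballyMinimal := by
  rw [zywinaCurve_eq_intCast]
  refine isGloballyMinimal_of_int_criterion _ _ _ _ _ fun ℓ hℓ hboth => ?_
  have h12 := hboth.1
  rw [discOf_zywina, ← zywinaCurveInt_Δ] at h12
  exact not_pow_twelve_dvd_Δ h ℓ hℓ h12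

/-- The tree's integral model of `E_{m,n}` is `zywinaCurveInt m n`. [cite: Zywina2025, Thm 1.2] -/
theorem integralModelInt_zywinaCurve :
    haveI := isGloballyMinimal_zywinaCurve h
    integralModelInt (zywinaCurve m n) = zywinaCurveInt m n := by
  haveI := isGloballyMinimal_zywinaCurve h
  have key : ∀ (X : WeierstrassCurve ℚ) [X.IsGloballyMinimal],
      (zywinaCurveInt m n).baseChange ℚ = X → integralModelInt X = zywinaCurveInt m n := by
    rintro X _ rfl
    exact integralModelInt_baseChange_int (zywinaCurveInt m n)
  exact key _ (zywinaCurveInt_baseChange m n)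

/-- The minimal discriminant of `E_{m,n}` is `Δ(zywinaCurveInt m n) = 2⁸3²mq³r²`.
[cite: Zywina2025, §3 (discriminant of E_{m,n})] -/
theorem minimalDiscriminantInt_zywinaCurve :
    haveI := isGloballyMinimal_zywinaCurve h
    minimalDiscriminantInt (zywinaCurve m n) = (zywinaCurveInt m n).Δ := by
  haveI := isGloballyMinimal_zywinaCurve h
  rw [minimalDiscriminantInt, integralModelInt_zywinaCurve h]

omit h in
/-- `3 ∣ Δ(E_{m,n})`. [cite: Zywina2025, §3 (discriminant of E_{m,n})] -/
theorem three_dvd_Δ : (3 : ℤ) ∣ (zywinaCurveInt m n).Δ := by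
  rw [zywinaCurveInt_Δ]
  exact ⟨2 ^ 8 * 3 * (m : ℤ) * ((m + 16 * n ^ 2 : ℕ) : ℤ) ^ 3 * ((m + 25 * n ^ 2 : ℕ) : ℤ) ^ 2,
    by ring⟩

/-- `3 ∤ c₄(E_{m,n}) = 16q(13m + 100n²)` (`q ≡ 2`, `m ≡ 2`, `n ≡ 0 (mod 3)`).
[cite: Zywina2025, Thm 1.2 (the congruences mod 24)] -/
theorem not_three_dvd_c₄ : ¬ (3 : ℤ) ∣ (zywinaCurveInt m n).c₄ := by
  obtain ⟨-, -, -, -, hm, hq, -⟩ := id h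
  have hn3 : 3 ∣ n := three_dvd_n h
  rw [zywinaCurveInt_c₄]
  intro hd
  have h3 : Prime (3 : ℤ) := Int.prime_three
  rcases h3.dvd_or_dvd hd with h1 | h1
  · rcases h3.dvd_or_dvd h1 with h2 | h2
    · norm_num at h2
    · have h2' : ((3 : ℕ) : ℤ) ∣ ((m + 16 * n ^ 2 : ℕ) : ℤ) := h2
      rw [Int.natCast_dvd_natCast] at h2'
      omega
  · have h1' : ((3 : ℕ) : ℤ) ∣ ((13 * m + 100 * n ^ 2 : ℕ) : ℤ) := by push_cast; exact h1
    rw [Int.natCast_dvd_natCast] at h1'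
    have h100 : 3 ∣ 100 * n ^ 2 := Dvd.dvd.mul_left (dvd_pow hn3 two_ne_zero) 100
    have h13 : 3 ∣ 13 * m := (Nat.dvd_add_left h100).mp h1'
    omega

/-- `v₃(Δ_min(E_{m,n})) = 2` (the factor `3²`; `3 ∤ 2mqr`): Kodaira type `I₂` at `3`.
[cite: Zywina2025, §3 (discriminant of E_{m,n})] -/
theorem padicValInt_three_Δ : padicValInt 3 (zywinaCurveInt m n).Δ = 2 := by
  have P := h.params
  obtain ⟨-, -, -, -, hm, hq, hr⟩ := id h
  rw [zywinaCurveInt_Δ]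
  have hm3 : ¬ 3 ∣ m := by omega
  have hq3 : ¬ 3 ∣ m + 16 * n ^ 2 := by omega
  have hr3 : ¬ 3 ∣ m + 25 * n ^ 2 := by omega
  haveI : Fact (Nat.Prime 3) := ⟨Nat.prime_three⟩
  have e : (2 ^ 8 * 3 ^ 2 * (m : ℤ) * ((m + 16 * n ^ 2 : ℕ) : ℤ) ^ 3 * ((m + 25 * n ^ 2 : ℕ) : ℤ) ^ 2)
      = ((2 ^ 8 * 3 ^ 2 * m * (m + 16 * n ^ 2) ^ 3 * (m + 25 * n ^ 2) ^ 2 : ℕ) : ℤ) := by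
    push_cast; ring
  rw [e, padicValInt.of_nat]
  have hm0 : m ≠ 0 := P.m_prime.ne_zero
  have hq0 : m + 16 * n ^ 2 ≠ 0 := P.q_prime.ne_zero
  have hr0 : m + 25 * n ^ 2 ≠ 0 := P.r_prime.ne_zero
  rw [padicValNat.mul (by positivity) (by positivity), padicValNat.mul (by positivity) (by positivity),
    padicValNat.mul (by positivity) (by positivity), padicValNat.mul (by positivity) (by positivity),
    padicValNat.pow, padicValNat.pow, padicValNat.pow, padicValNat.pow, padicValNat_self,
    padicValNat_primes (p := 3) (q := 2) (by norm_num),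
    padicValNat.eq_zero_of_not_dvd hm3, padicValNat.eq_zero_of_not_dvd hq3,
    padicValNat.eq_zero_of_not_dvd hr3]


end Admissible

/-! ### §3 The local structure at the multiplicative prime `3` -/

/-- The place of `𝓞 ℚ` over `3`. [folklore] -/
private def v₃ : HeightOneSpectrum (𝓞 ℚ) := (primesEquiv (R := 𝓞 ℚ)).symm ⟨3, Nat.prime_three⟩

/-- `v₃` lies over `3`. [folklore] -/
private theorem primesEquiv_v₃ : primesEquiv v₃ = ⟨3, Nat.prime_three⟩ := Equiv.apply_symm_apply _ _

/-- `v₃` lies over `3` (as a natural number). [folklore] -/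
private theorem primesEquiv_v₃_val : ((primesEquiv v₃ : Nat.Primes) : ℕ) = 3 :=
  congrArg Subtype.val primesEquiv_v₃

section AdmissibleLocal

open Literature.NumberTheory.EllipticCurves.LocalTorsionMult

variable {m n : ℕ} (h : ZywinaAdmissible m n)
include h

/-- **`E_{m,n}` has multiplicative reduction at `3`** (`3 ∣ Δ_min`, `3 ∤ c₄`; Silverman *AEC*
VII.5.1(b)). The instances are `isElliptic_zywinaCurve h`, `isGloballyMinimal_zywinaCurve h`.
[cite: Zywina2025, §3 (discriminant of E_{m,n})] -/
theorem hasMultiplicativeReductionAtPrime_three [(zywinaCurve m n).IsElliptic]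
    [(zywinaCurve m n).IsGloballyMinimal] :
    (zywinaCurve m n).HasMultiplicativeReductionAtPrime 3 := by
  have hΔ : ((primesEquiv v₃ : ℕ) : ℤ) ∣ minimalDiscriminantInt (zywinaCurve m n) := by
    rw [primesEquiv_v₃_val, minimalDiscriminantInt_zywinaCurve h]
    exact_mod_cast three_dvd_Δ (m := m) (n := n)
  have hc₄ : ¬ ((primesEquiv v₃ : ℕ) : ℤ) ∣ (integralModelInt (zywinaCurve m n)).c₄ := by
    rw [primesEquiv_v₃_val, integralModelInt_zywinaCurve h]
    exact_mod_cast not_three_dvd_c₄ h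
  have hv : (zywinaCurve m n).HasMultiplicativeReductionAt v₃ :=
    hasMultiplicativeReductionAt_of_dvd_of_not_dvd (zywinaCurve m n) v₃ hΔ hc₄
  have key : ∀ q : Nat.Primes, primesEquiv v₃ = q →
      (haveI := Fact.mk q.2; (zywinaCurve m n).HasMultiplicativeReductionAtPrime (q : ℕ)) := by
    rintro q rfl
    exact (hasMultiplicativeReductionAtPrime_iff_hasMultiplicativeReductionAt_ringOfIntegers
      (zywinaCurve m n) v₃).mpr hv
  exact key ⟨3, Nat.prime_three⟩ primesEquiv_v₃

/-- `E_{m,n}` is multiplicative at the place `v₃`, and split there iff split at the prime `3`.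
[folklore] -/
private theorem mult_at_v₃ [(zywinaCurve m n).IsElliptic] [(zywinaCurve m n).IsGloballyMinimal] :
    (zywinaCurve m n).HasMultiplicativeReductionAt v₃ ∧
      ((zywinaCurve m n).HasSplitMultiplicativeReductionAtPrime 3 ↔
        (zywinaCurve m n).HasSplitMultiplicativeReductionAt v₃) := by
  refine ⟨?_, ?_⟩
  · have key : ∀ q : Nat.Primes, primesEquiv v₃ = q →
        (haveI := Fact.mk q.2; (zywinaCurve m n).HasMultiplicativeReductionAtPrime (q : ℕ)) →
          (zywinaCurve m n).HasMultiplicativeReductionAt v₃ := by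
      rintro q rfl hq
      exact (hasMultiplicativeReductionAtPrime_iff_hasMultiplicativeReductionAt_ringOfIntegers
        (zywinaCurve m n) v₃).mp hq
    exact key ⟨3, Nat.prime_three⟩ primesEquiv_v₃ (hasMultiplicativeReductionAtPrime_three h)
  · have key : ∀ q : Nat.Primes, primesEquiv v₃ = q →
        ((haveI := Fact.mk q.2; (zywinaCurve m n).HasSplitMultiplicativeReductionAtPrime (q : ℕ)) ↔
          (zywinaCurve m n).HasSplitMultiplicativeReductionAt v₃) := by
      rintro q rfl
      exact hasSplitMultiplicativeReductionAtPrime_iff_hasSplitMultiplicativeReductionAt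
        (zywinaCurve m n) v₃
    exact key ⟨3, Nat.prime_three⟩ primesEquiv_v₃

/-- **`c₃(E_{m,n}) ∣ 2`**: Kodaira type `I₂` at `3` — split: `c₃ = ord₃(Δ_min) = 2`; non-split:
`c₃ ∈ {1, 2}` (Silverman *AEC* VII.6.1; tree:
`localTamagawaNumber_eq_ordMinimalDiscriminant_of_hasSplitMultiplicativeReductionAt`,
`localTamagawaNumber_of_hasNonsplitMultiplicativeReductionAt_holds`). [cite: SilvermanAEC2009, Thm VII.6.1] -/
theorem localTamagawaNumber_three_dvd_two [(zywinaCurve m n).IsElliptic]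
    [(zywinaCurve m n).IsGloballyMinimal] :
    ((zywinaCurve m n).baseChange ℚ_[3]).localTamagawaNumber ℤ_[3] ∣ 2 := by
  obtain ⟨hmultv, -⟩ := mult_at_v₃ h
  haveI : Finite (IsLocalRing.ResidueField (v₃.adicCompletionIntegers ℚ)) :=
    HeightOneSpectrum.finite_residueField_adicCompletionIntegers ℚ v₃
  rw [localTamagawaNumber_padic_eq_holds (zywinaCurve m n) v₃ 3 primesEquiv_v₃_val]
  by_cases hs : (zywinaCurve m n).HasSplitMultiplicativeReductionAt v₃
  · rw [localTamagawaNumber_eq_ordMinimalDiscriminant_of_hasSplitMultiplicativeReductionAt v₃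
        (zywinaCurve m n) hs,
      ordMinimalDiscriminant_eq_padicValInt (zywinaCurve m n) v₃ primesEquiv_v₃_val,
      minimalDiscriminantInt_zywinaCurve h, padicValInt_three_Δ h]
  · rw [localTamagawaNumber_of_hasNonsplitMultiplicativeReductionAt_holds v₃ (zywinaCurve m n)
        hmultv hs]
    split_ifs <;> norm_num

/-- **`#Ẽ_ns(𝔽₃) ∣ 4`** for `E_{m,n}`: `3 - 1 = 2` points if the node is split, `3 + 1 = 4` if not
(Silverman *AEC* Ex. 3.5; tree `reductionPointCount_of_mult`). [cite: SilvermanAEC2009, Exercise 3.5] -/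
theorem reductionPointCount_three_dvd_four [(zywinaCurve m n).IsElliptic]
    [(zywinaCurve m n).IsGloballyMinimal] :
    reductionPointCount (zywinaCurve m n) 3 ∣ 4 := by
  obtain ⟨hs, hns⟩ := reductionPointCount_of_mult (zywinaCurve m n) 3
    (hasMultiplicativeReductionAtPrime_three h)
  by_cases hsp : (zywinaCurve m n).HasSplitMultiplicativeReductionAtPrime 3
  · have e : reductionPointCount (zywinaCurve m n) 3 = 2 := by have := hs hsp; omega
    rw [e]; norm_num
  · rw [hns hsp]

/-- **Every torsion point of `E_{m,n}(ℚ)` is killed by `8`** (Zywina Lemma 3.4, first half — "any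
element of finite order … has order equal to a power of `2`" — run at the prime `3`: the index
`[E(ℚ₃) : E₁(ℚ₃)] = c₃ · #Ẽ_ns(𝔽₃)` (Silverman *AEC* VII.2.1, VII.6.1; tree `index_formalFiltration`)
divides `2 · 4 = 8`, so the image of a rational torsion point `P` satisfies `8P ∈ E₁(ℚ₃)`, and a
RATIONAL point of `E₁(ℚ₃)` is never torsion (AEC VII.3.1; tree `not_isOfFinAddOrder_of_one_lt_norm`);
hence `8P = O`). [cite: Zywina2025, Lemma 3.4 (proof, first paragraph)] -/
theorem eight_nsmul_eq_zero_of_isOfFinAddOrder (P : (zywinaCurve m n).toAffine.Point)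
    (hP : IsOfFinAddOrder P) : 8 • P = 0 := by
  classical
  haveI := isElliptic_zywinaCurve h
  haveI := isGloballyMinimal_zywinaCurve h
  haveI : ((zywinaCurve m n).baseChange ℚ_[3]).IsMinimal ℤ_[3] :=
    isMinimal_map_padic_of_isGloballyMinimal (zywinaCurve m n) 3
  haveI : ((zywinaCurve m n).baseChange ℚ_[3]).IsElliptic := by rw [baseChange]; infer_instance
  -- `#(reduction of E ⊗ ℚ₃) = reductionPointCount E 3`
  have hcard : Nat.card (((zywinaCurve m n).baseChange ℚ_[3]).reduction ℤ_[3]).toAffine.Point =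
      reductionPointCount (zywinaCurve m n) 3 := by
    have key : ∀ (X : WeierstrassCurve ℚ_[3]) [X.IsMinimal ℤ_[3]],
        ((integralModelInt (zywinaCurve m n)).map (Int.castRingHom ℤ_[3])).baseChange ℚ_[3] = X →
          Nat.card (X.reduction ℤ_[3]).toAffine.Point = reductionPointCount (zywinaCurve m n) 3 := by
      intro X _ hX
      subst hX
      rw [reduction_baseChange_eq]
      exact natCard_point_padicModel_residue (zywinaCurve m n) 3
    exact key _ (padicModel_baseChange (zywinaCurve m n) 3)
  -- the index of `E₁(ℚ₃)` divides `8`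
  set H : AddSubgroup ((zywinaCurve m n).baseChange ℚ_[3]).toAffine.Point :=
    ((zywinaCurve m n).baseChange ℚ_[3]).formalFiltration 1 with hH
  have hidx : H.index ∣ 8 := by
    rw [hH, index_formalFiltration ((zywinaCurve m n).baseChange ℚ_[3]) (le_refl 1), pow_zero,
      mul_one, hcard]
    calc ((zywinaCurve m n).baseChange ℚ_[3]).localTamagawaNumber ℤ_[3] *
          reductionPointCount (zywinaCurve m n) 3 ∣ 2 * 4 :=
        mul_dvd_mul (localTamagawaNumber_three_dvd_two h) (reductionPointCount_three_dvd_four h)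
      _ = 8 := by norm_num
  -- the image of `P` in `E(ℚ₃)`: `8 • ι P ∈ E₁(ℚ₃)`
  let ι : (zywinaCurve m n).toAffine.Point →+ ((zywinaCurve m n).baseChange ℚ_[3]).toAffine.Point :=
    Affine.Point.baseChange (W' := (zywinaCurve m n).toAffine) ℚ ℚ_[3]
  obtain ⟨k, hk⟩ := hidx
  have hmem0 : H.index • ι P ∈ H := AddSubgroup.nsmul_index_mem H _
  have hmem : 8 • ι P ∈ H := by
    rw [hk, mul_nsmul]
    exact H.nsmul_mem hmem0 k
  -- `8 • P` is a rational torsion point lying in `E₁(ℚ₃)`: it is `O`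
  have hfin : IsOfFinAddOrder (8 • P) := hP.nsmul
  generalize hQ : 8 • P = Q at hfin
  have hmemQ : ι Q ∈ H := by rw [← hQ, map_nsmul]; exact hmem
  rcases Q with _ | ⟨x, y, hxy⟩
  · rfl
  · exfalso
    have hker : ((zywinaCurve m n).baseChange ℚ_[3]).IsInReductionKernel (ι (.some x y hxy)) :=
      ((mem_formalFiltration_iff _).mp hmemQ).1
    have hx' : 1 < ‖(Algebra.ofId ℚ ℚ_[3]) x‖ := hker
    have hx : 1 < ‖(x : ℚ_[3])‖ := by
      have e' : (Algebra.ofId ℚ ℚ_[3]) x = (x : ℚ_[3]) := by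
        rw [Algebra.ofId_apply, eq_ratCast]
      rwa [e'] at hx'
    exact not_isOfFinAddOrder_of_one_lt_norm (W := zywinaCurve m n) (p := 3) le_rfl hxy hx hfin

end AdmissibleLocal

/-! ### §4 The `2`-primary part and Lemma 3.4 -/

section TwoPart

open _root_.WeierstrassCurve.Affine (sqClass sqClass_mul sqClass_eq_one_iff SqUnits.mul_self)

variable {m n : ℕ} (h : ZywinaAdmissible m n)
include h

omit h in
/-- `2 · P₀ = O` on `E_{m,n}` (tree `twoTorsionPoint_add_twoTorsionPoint`, restated with the ambient
`DecidableEq ℚ` instance of the group law). [folklore] -/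
private theorem two_nsmul_twoTorsionPoint [(zywinaCurve m n).IsElliptic] :
    2 • (zywinaCurve m n).twoTorsionPoint = 0 := by
  -- the tree lemma carries the classical `DecidableEq ℚ`; bridge by `Subsingleton.elim`
  have hTT : (zywinaCurve m n).twoTorsionPoint + (zywinaCurve m n).twoTorsionPoint = 0 := by
    suffices aux : ∀ [d : DecidableEq ℚ],
        (zywinaCurve m n).twoTorsionPoint + (zywinaCurve m n).twoTorsionPoint = 0 from aux
    intro d
    obtain rfl : d = fun a b => Classical.propDecidable (a = b) := Subsingleton.elim _ _
    exact twoTorsionPoint_add_twoTorsionPoint _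
  rw [two_nsmul]
  exact hTT

omit h in
/-- `α(P + Q) = α(P) α(Q)` on `E_{m,n}` (tree `xSqClass_add`, restated with the ambient
`DecidableEq ℚ` instance of the group law). [folklore] -/
private theorem xSqClass_add' [(zywinaCurve m n).IsElliptic] (P Q : (zywinaCurve m n).toAffine.Point) :
    (zywinaCurve m n).xSqClass (P + Q) = (zywinaCurve m n).xSqClass P * (zywinaCurve m n).xSqClass Q := by
  convert xSqClass_add (zywinaCurve m n) P Q

/-- `q · r` (two distinct primes) is not a square. [folklore] -/
private theorem not_isSquare_q_mul_r : ¬ IsSquare ((m + 16 * n ^ 2) * (m + 25 * n ^ 2)) := by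
  have P := h.params
  set q : ℕ := m + 16 * n ^ 2 with hq
  set r : ℕ := m + 25 * n ^ 2 with hr
  have hqr : q < r := by have := P.n_pos; rw [hq, hr]; nlinarith
  rintro ⟨s, hs⟩
  have hqp := P.q_prime
  have hrp := P.r_prime
  have hqs : q ∣ s := by
    have : q ∣ s * s := ⟨r, by rw [← hs]⟩
    exact (Nat.Prime.dvd_mul hqp).mp this |>.elim id id
  obtain ⟨t, rfl⟩ := hqs
  have hr' : r = q * t * t := by
    have : q * r = q * (q * t * t) := by rw [hs]; ring
    exact Nat.eq_of_mul_eq_mul_left hqp.pos this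
  have hqr' : q ∣ r := ⟨t * t, by rw [hr']; ring⟩
  have := (Nat.prime_dvd_prime_iff_eq hqp hrp).mp hqr'
  omega

/-- **`E_{m,n}(ℚ)[2] = {O, P₀}`**, `P₀ = (0, 0)` (Zywina, Lemma 3.4: "The only element of order `2`
in `E(ℚ)` is `P₀ = (0,0)`"; tree: `natCard_torsionBy_two_zywinaCurve`). The instance is
`isElliptic_zywinaCurve h`. [cite: Zywina2025, Lemma 3.4 (proof)] -/
theorem eq_zero_or_eq_twoTorsionPoint_of_two_nsmul_eq_zero [(zywinaCurve m n).IsElliptic]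
    (P : (zywinaCurve m n).toAffine.Point) (h2 : 2 • P = 0) :
    P = 0 ∨ P = (zywinaCurve m n).twoTorsionPoint := by
  set S := AddSubgroup.torsionBy (zywinaCurve m n).toAffine.Point (2 : ℤ) with hS
  have hcard : Nat.card S = 2 := natCard_torsionBy_two_zywinaCurve h
  have hmem : ∀ {Q : (zywinaCurve m n).toAffine.Point}, 2 • Q = 0 → Q ∈ S := fun {Q} hQ =>
    (AddSubgroup.torsionBy.nsmul_iff (n := 2)).mpr hQ
  have hT2 : 2 • (zywinaCurve m n).twoTorsionPoint = 0 := two_nsmul_twoTorsionPoint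
  have hT0 : (zywinaCurve m n).twoTorsionPoint ≠ 0 := twoTorsionPoint_ne_zero _
  by_cases hP0 : P = 0
  · exact Or.inl hP0
  right
  obtain ⟨y, -, huniq⟩ := (Nat.card_eq_two_iff' (⟨0, hmem (nsmul_zero 2)⟩ : S)).mp hcard
  have e₁ := huniq ⟨P, hmem h2⟩ (fun e => hP0 (congrArg Subtype.val e))
  have e₂ := huniq ⟨_, hmem hT2⟩ (fun e => hT0 (congrArg Subtype.val e))
  exact congrArg Subtype.val (e₁.trans e₂.symm)

/-- **`P₀ ∉ 2E_{m,n}(ℚ)`** (Zywina, Lemma 3.4: "`P₀ = 2P = φ̂(φ(P)) ∈ φ̂(E′(ℚ))` contradicts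
Lemma 3.3(ii)"; here via the `2`-descent class map `α(x, y) = [x]`, a homomorphism to `ℚ^×/ℚ^×²`
(tree `xSqClass_add`): `α(2Q) = α(Q)² = 1` but `α(P₀) = [a₄] = [4qr] ≠ 1`, `q ≠ r` primes).
[cite: Zywina2025, Lemma 3.4 (proof, second paragraph) with Lemma 3.3(ii)] -/
theorem twoTorsionPoint_ne_two_nsmul [(zywinaCurve m n).IsElliptic]
    (Q : (zywinaCurve m n).toAffine.Point) : 2 • Q ≠ (zywinaCurve m n).twoTorsionPoint := by
  have P := h.params
  intro hQ
  have hα := congrArg (zywinaCurve m n).xSqClass hQ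
  rw [two_nsmul, xSqClass_add', SqUnits.mul_self, xSqClass_twoTorsionPoint] at hα
  -- `a₄ = 4qr` is not a square
  have ha₄ : (zywinaCurve m n).a₄ = 4 * ((m + 16 * n ^ 2 : ℕ) : ℚ) * ((m + 25 * n ^ 2 : ℕ) : ℚ) := by
    simp only [zywinaCurve]; push_cast; ring
  have hq0 : (0 : ℚ) < ((m + 16 * n ^ 2 : ℕ) : ℚ) := by exact_mod_cast P.q_prime.pos
  have hr0 : (0 : ℚ) < ((m + 25 * n ^ 2 : ℕ) : ℚ) := by exact_mod_cast P.r_prime.pos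
  have hne : (zywinaCurve m n).a₄ ≠ 0 := by rw [ha₄]; positivity
  obtain ⟨u, hu⟩ := (sqClass_eq_one_iff hne).mp hα.symm
  apply not_isSquare_q_mul_r h
  have e := ha₄.symm.trans hu
  push_cast at e
  have hsq : IsSquare ((((m + 16 * n ^ 2) * (m + 25 * n ^ 2) : ℕ)) : ℚ) :=
    ⟨u / 2, by push_cast; linear_combination (1 / 4 : ℚ) * e⟩
  exact Rat.isSquare_natCast_iff.mp hsq

/-- **Zywina 2025, Lemma 3.4: `E_{m,n}(ℚ)_tors = {O, P₀}`** — every torsion point of `E_{m,n}(ℚ)`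
is `O` or `P₀ = (0, 0)` (`8P = O` by §3; then `4P, 2P ∈ E(ℚ)[2] = {O, P₀}` and `P₀ ∉ 2E(ℚ)` force
`4P = 2P = O`). The instance is `isElliptic_zywinaCurve h`. [cite: Zywina2025, Lemma 3.4] -/
theorem eq_zero_or_eq_twoTorsionPoint_of_isOfFinAddOrder [(zywinaCurve m n).IsElliptic]
    (P : (zywinaCurve m n).toAffine.Point) (hP : IsOfFinAddOrder P) :
    P = 0 ∨ P = (zywinaCurve m n).twoTorsionPoint := by
  have h8 := eight_nsmul_eq_zero_of_isOfFinAddOrder h P hP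
  have h4 : 4 • P = 0 := by
    rcases eq_zero_or_eq_twoTorsionPoint_of_two_nsmul_eq_zero h (4 • P)
      (by rw [← mul_nsmul]; exact h8) with h0 | hT
    · exact h0
    · exact absurd (by rw [← mul_nsmul]; exact hT) (twoTorsionPoint_ne_two_nsmul h (2 • P))
  have h2 : 2 • P = 0 := by
    rcases eq_zero_or_eq_twoTorsionPoint_of_two_nsmul_eq_zero h (2 • P)
      (by rw [← mul_nsmul]; exact h4) with h0 | hT
    · exact h0
    · exact absurd hT (twoTorsionPoint_ne_two_nsmul h P)
  exact eq_zero_or_eq_twoTorsionPoint_of_two_nsmul_eq_zero h P h2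

/-- **`#E_{m,n}(ℚ)_tors = 2`** (Zywina, Lemma 3.4: "the torsion subgroup of `E(ℚ)` is the cyclic
group of order `2` generated by `P₀`"). [cite: Zywina2025, Lemma 3.4] -/
theorem natCard_torsion_zywinaCurve :
    Nat.card (AddCommGroup.torsion (zywinaCurve m n).toAffine.Point) = 2 := by
  haveI := isElliptic_zywinaCurve h
  set T := (zywinaCurve m n).twoTorsionPoint with hTdef
  have hT2 : 2 • T = 0 := two_nsmul_twoTorsionPoint
  have hT0 : T ≠ 0 := twoTorsionPoint_ne_zero _
  have hTt : T ∈ AddCommGroup.torsion (zywinaCurve m n).toAffine.Point :=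
    (AddCommGroup.mem_torsion _).mpr (isOfFinAddOrder_iff_nsmul_eq_zero.mpr ⟨2, two_pos, hT2⟩)
  have h0t : (0 : (zywinaCurve m n).toAffine.Point) ∈
      AddCommGroup.torsion (zywinaCurve m n).toAffine.Point := AddSubgroup.zero_mem _
  rw [Nat.card_eq_two_iff' (⟨0, h0t⟩ : AddCommGroup.torsion (zywinaCurve m n).toAffine.Point)]
  refine ⟨⟨T, hTt⟩, fun e => hT0 (congrArg Subtype.val e), fun Q hQ => ?_⟩
  have hQt : IsOfFinAddOrder (Q : (zywinaCurve m n).toAffine.Point) :=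
    (AddCommGroup.mem_torsion _).mp Q.2
  rcases eq_zero_or_eq_twoTorsionPoint_of_isOfFinAddOrder h _ hQt with e | e
  · exact absurd (Subtype.ext e) hQ
  · exact Subtype.ext e

/-- **`#E_{m,n}(ℚ)_tors = 2`** in the tree's BSD vocabulary (`WeierstrassCurve.torsionOrder`, the
`#E(ℚ)_tors` of the BSD quotient). [cite: Zywina2025, Lemma 3.4] -/
theorem torsionOrder_zywinaCurve : (zywinaCurve m n).torsionOrder = 2 := by
  -- `torsionOrder` carries the classical `DecidableEq ℚ` in the group law; bridge by congruence
  unfold WeierstrassCurve.torsionOrder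
  convert natCard_torsion_zywinaCurve h

/-- **Zywina 2025, Theorem 1.2 as printed: `E_{m,n}(ℚ) ≅ ℤ/2ℤ × ℤ²`**, read as
`rank E_{m,n}(ℚ) = 2` (tree `mordellWeilRank_zywinaCurve`, Lemma 3.5) and `#E_{m,n}(ℚ)_tors = 2`
(Lemma 3.4, this file), for every admissible `(m, n)`. [cite: Zywina2025, Thm 1.2] -/
theorem mordellWeilRank_eq_two_and_torsionOrder_eq_two :
    (zywinaCurve m n).mordellWeilRank = 2 ∧ (zywinaCurve m n).torsionOrder = 2 :=
  ⟨mordellWeilRank_zywinaCurve h, torsionOrder_zywinaCurve h⟩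

end TwoPart

/-- **Zywina 2025, Theorems 1.1 + 1.2 with the torsion clause**: modulo the named fact
`zywinaSet_infinite` (infinitely many admissible pairs; derived in the tree from Tao–Ziegler,
`zywinaSet_infinite_of_taoZiegler`), there are infinitely many `j`-invariants of elliptic curves
`E/ℚ` with `E(ℚ) ≅ ℤ/2ℤ × ℤ²` (`rank = 2`, `#E(ℚ)_tors = 2`). [cite: Zywina2025, Thm 1.1, Thm 1.2] -/
theorem infinite_setOf_j_mordellWeilRank_eq_two_and_torsionOrder_eq_two (h : zywinaSet_infinite) :
    {j : ℚ | ∃ (W : WeierstrassCurve ℚ) (hW : W.IsElliptic),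
      @WeierstrassCurve.j _ _ W hW = j ∧ W.mordellWeilRank = 2 ∧ W.torsionOrder = 2}.Infinite := by
  classical
  let f : ℕ × ℕ → ℚ := fun p =>
    if hp : ZywinaAdmissible p.1 p.2 then
      @WeierstrassCurve.j _ _ (zywinaCurve p.1 p.2) (isElliptic_zywinaCurve hp) else 0
  have hinj : Set.InjOn f zywinaSet := by
    rintro ⟨m₁, n₁⟩ h₁ ⟨m₂, n₂⟩ h₂ he
    have h₁' : ZywinaAdmissible m₁ n₁ := h₁
    have h₂' : ZywinaAdmissible m₂ n₂ := h₂
    simp only [f, dif_pos h₁', dif_pos h₂'] at he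
    obtain ⟨rfl, rfl⟩ := eq_of_j_eq h₁' h₂' he
    rfl
  refine Set.infinite_of_injOn_mapsTo hinj ?_ h
  rintro ⟨m, n⟩ hp
  have hp' : ZywinaAdmissible m n := hp
  exact ⟨zywinaCurve m n, isElliptic_zywinaCurve hp', by simp only [f, dif_pos hp'],
    mordellWeilRank_zywinaCurve hp', torsionOrder_zywinaCurve hp'⟩

end Literature.NumberTheory.EllipticCurves.Zywina2025

end
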